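import Summits.Ventures.HSemireg.WedgeHankelRecurrenceGaussLeastSquares

/-!
# Venture HSemireg — **BESSEL'S INEQUALITY AND PARSEVAL'S IDENTITY FOR THE FINITE ORTHOGONAL SYSTEM; THE REPRODUCING KERNEL AS AN IDEMPOTENT**: with `c_k = Σ_l ν_l P(w_l) q_k(w_l) ∕ h_k`,
# `Σ_l ν_l (S_n P)(w_l)² = Σ_{k≤n} c_k² h_k` and `Σ_l ν_l P(w_l)² = Σ_{k≤n} c_k² h_k + Σ_l ν_l (P − S_n P)(w_l)²` (so `Σ c_k² h_k ≤ Σ ν P²`, with equality iff `deg P ≤ n` in the sense `P = S_n P`);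
# and `Σ_l ν_l K_n(x, w_l) K_n(w_l, y) = K_n(x, y)`, `K_n(x, y)² ≤ K_n(x, x) K_n(y, y)`

HONEST FRAMING. Part of the Lean index of the computation cell `pub-hsemireg` (seat p10 gen 43, Sunday typer «UNIFORM-IN-n»).  Real polynomials and finite sums only; no variety, no cohomology
theory, no sheaf, no Ext group and no semiregularity map is constructed here; nothing here says that HC / HC_CM / HC_AV holds; no Literature fact (unproved `Prop`) is declared or used.  Custodian
versions as in `WedgeHankelSiegelIdeal` (1/3).
SOURCES (cited).  F. W. Bessel (1828) ∕ M.-A. Parseval (1806); G. Szegő, *Orthogonal Polynomials*, §3.1 (3.1.5)–(3.1.11) (orthogonal expansion, Bessel's inequality, the kernel `K_n(x, y)` and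
`K_n(x, x) K_n(y, y) ≥ K_n(x, y)²`); P. J. Davis, *Interpolation and Approximation* (1963), Thm 8.5.2 ∕ 8.6.1; N. Aronszajn, *Theory of reproducing kernels*, Trans. AMS 68 (1950) §2 (reproducing
property and the kernel inequality).
PROOF TYPED HERE.  `Σ ν (S_n P) q_k = c_k h_k` (N317 `fourier_partialSum_orthogonal_basis`), hence `Σ ν (S_n P)² = Σ_k c_k · c_k h_k`; Parseval–Bessel from the orthogonality `P − S_n P ⟂ S_n P`
(N317 `fourier_partialSum_orthogonal`, `deg S_n P ≤ n`); the kernel items from N277 `kernel_reproducing` (with `P = K_n(·, y)`) and N296 `eval_sq_le_kernel_mul_sum_sq` + `sum_mul_eval_kernelPoly_sq`.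
DEDUP DISCLOSURE (`rg -n 'bessel|parseval|kernel_compose|kernelPoly_sq_le_mul' Summits/Ventures/HSemireg`, 2026-09-03): N296 `sum_mul_eval_kernelPoly_sq` is the diagonal case `x = y` of the composition; the
rest is new.  NAMECHECK: the short name `kernel_sq_le` is taken elsewhere in the tree, hence `kernelPoly_sq_le_mul`.  The 5 names below: 0 hits tree-wide.

WHAT IS IN THE TREE.  N317 `fourier_partialSum_orthogonal_basis`, `fourier_partialSum_orthogonal`; N277 `kernel_reproducing`, `natDegree_reproducingKernel_le`; N296 `eval_sq_le_kernel_mul_sum_sq`,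
`sum_mul_eval_kernelPoly_sq`.
THIS FILE (namespace `Summit.Ventures.HSemireg.Wedge.HankelOuter` continued; CHAINED on N317 (import), N277, N296; 0 definitions):
* §1083 `sum_mul_partialSum_mul_basis` (`Σ ν (S_n P) q_k = c_k h_k`, `k ≤ n`), **`parseval_partialSum`** (`Σ ν (S_n P)² = Σ_{k≤n} c_k² h_k`), **`bessel_parseval`** (`Σ ν P² = Σ_{k≤n} c_k² h_k + Σ ν (P − S_n P)²`,
  hence Bessel `Σ c_k² h_k ≤ Σ ν P²` for `ν ≥ 0`), **`kernel_compose`** (`Σ_l ν_l K_n(x, w_l) K_n(w_l, y) = K_n(x, y)`), **`kernelPoly_sq_le_mul`** (`K_n(x, y)² ≤ K_n(x, x) K_n(y, y)`, `ν ≥ 0`).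
CAVEATS.  Discrete positive measures (`h_k ≠ 0` for `k ≤ n`).  Nothing Ext-side.  New names only.
-/

open Module Polynomial
open scoped Matrix Polynomial

namespace Summit.Ventures.HSemireg.Wedge.HankelOuter

/-! ## §1083. Bessel, Parseval, and the kernel as an idempotent -/

/-- **`Σ ν (S_n P) q_k = c_k h_k`** for `k ≤ n`. [Szegő (3.1.5); this file, §1083] -/
theorem sum_mul_partialSum_mul_basis {N n : ℕ} {ν w : Fin N → ℝ} {q : ℕ → ℝ[X]} (hdeg : ∀ k, k ≤ n → (q k).natDegree = k)
    (horth : ∀ k, k ≤ n → ∀ G : ℝ[X], G.natDegree < k → ∑ l, ν l * (q k * G).eval (w l) = 0) (hh : ∀ k, k ≤ n → ∑ l, ν l * ((q k).eval (w l)) ^ 2 ≠ 0)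
    (P : ℝ[X]) {k : ℕ} (hk : k ≤ n) :
    ∑ l, ν l * ((∑ j ∈ Finset.range (n + 1), C ((∑ l', ν l' * (P.eval (w l') * (q j).eval (w l'))) / ∑ l', ν l' * ((q j).eval (w l')) ^ 2) * q j).eval (w l) * (q k).eval (w l)) =
      (∑ l', ν l' * (P.eval (w l') * (q k).eval (w l'))) := by
  have h := fourier_partialSum_orthogonal_basis hdeg horth hh P hk
  have hl : ∀ l, ν l * ((P - ∑ j ∈ Finset.range (n + 1), C ((∑ l', ν l' * (P.eval (w l') * (q j).eval (w l'))) / ∑ l', ν l' * ((q j).eval (w l')) ^ 2) * q j).eval (w l) * (q k).eval (w l)) =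
      ν l * (P.eval (w l) * (q k).eval (w l)) -
        ν l * ((∑ j ∈ Finset.range (n + 1), C ((∑ l', ν l' * (P.eval (w l') * (q j).eval (w l'))) / ∑ l', ν l' * ((q j).eval (w l')) ^ 2) * q j).eval (w l) * (q k).eval (w l)) := fun l => by
    rw [eval_sub]; ring
  rw [Finset.sum_congr rfl fun l _ => hl l, Finset.sum_sub_distrib, sub_eq_zero] at h
  exact h.symm

/-- **PARSEVAL FOR THE PARTIAL SUM: `Σ_l ν_l (S_n P)(w_l)² = Σ_{k≤n} c_k² h_k`** (`c_k = Σ ν P q_k ∕ h_k`). [Szegő (3.1.6); Davis Thm 8.6.1; this file, §1083] -/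
theorem parseval_partialSum {N n : ℕ} {ν w : Fin N → ℝ} {q : ℕ → ℝ[X]} (hdeg : ∀ k, k ≤ n → (q k).natDegree = k)
    (horth : ∀ k, k ≤ n → ∀ G : ℝ[X], G.natDegree < k → ∑ l, ν l * (q k * G).eval (w l) = 0) (hh : ∀ k, k ≤ n → ∑ l, ν l * ((q k).eval (w l)) ^ 2 ≠ 0) (P : ℝ[X]) :
    ∑ l, ν l * ((∑ j ∈ Finset.range (n + 1), C ((∑ l', ν l' * (P.eval (w l') * (q j).eval (w l'))) / ∑ l', ν l' * ((q j).eval (w l')) ^ 2) * q j).eval (w l)) ^ 2 =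
      ∑ k ∈ Finset.range (n + 1), ((∑ l', ν l' * (P.eval (w l') * (q k).eval (w l'))) / ∑ l', ν l' * ((q k).eval (w l')) ^ 2) ^ 2 * ∑ l', ν l' * ((q k).eval (w l')) ^ 2 := by
  set c : ℕ → ℝ := fun j => (∑ l', ν l' * (P.eval (w l') * (q j).eval (w l'))) / ∑ l', ν l' * ((q j).eval (w l')) ^ 2 with hc
  set S : ℝ[X] := ∑ j ∈ Finset.range (n + 1), C (c j) * q j with hS
  -- `Σ ν S² = Σ_k c_k Σ ν S q_k = Σ_k c_k (c_k h_k)`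
  have hSev : ∀ x, S.eval x = ∑ k ∈ Finset.range (n + 1), c k * (q k).eval x := fun x => by
    rw [hS, eval_finsetSum]; exact Finset.sum_congr rfl fun k _ => by rw [eval_mul, eval_C]
  have hl : ∀ l, ν l * (S.eval (w l)) ^ 2 = ∑ k ∈ Finset.range (n + 1), c k * (ν l * (S.eval (w l) * (q k).eval (w l))) := fun l => by
    rw [sq, hSev (w l), Finset.mul_sum, Finset.mul_sum]
    rw [← hSev (w l)]
    exact Finset.sum_congr rfl fun k _ => by ring
  rw [Finset.sum_congr rfl fun l _ => hl l, Finset.sum_comm]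
  refine Finset.sum_congr rfl fun k hk => ?_
  have hk' : k ≤ n := Nat.lt_succ_iff.1 (Finset.mem_range.1 hk)
  rw [← Finset.mul_sum, sum_mul_partialSum_mul_basis hdeg horth hh P hk', hc]
  simp only
  rw [sq, mul_assoc, div_mul_cancel₀ _ (hh k hk')]

/-- **BESSEL ∕ PARSEVAL: `Σ_l ν_l P(w_l)² = Σ_{k≤n} c_k² h_k + Σ_l ν_l (P − S_n P)(w_l)²`**; in particular `Σ_{k≤n} c_k² h_k ≤ Σ_l ν_l P(w_l)²` for `ν ≥ 0` (Bessel's inequality).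
[Bessel 1828; Szegő (3.1.6)–(3.1.7); Davis Thm 8.6.1; this file, §1083] -/
theorem bessel_parseval {N n : ℕ} {ν w : Fin N → ℝ} {q : ℕ → ℝ[X]} (hmonic : ∀ k, k ≤ n → (q k).Monic) (hdeg : ∀ k, k ≤ n → (q k).natDegree = k)
    (horth : ∀ k, k ≤ n → ∀ G : ℝ[X], G.natDegree < k → ∑ l, ν l * (q k * G).eval (w l) = 0) (hh : ∀ k, k ≤ n → ∑ l, ν l * ((q k).eval (w l)) ^ 2 ≠ 0) (P : ℝ[X]) :
    ∑ l, ν l * (P.eval (w l)) ^ 2 =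
      ∑ k ∈ Finset.range (n + 1), ((∑ l', ν l' * (P.eval (w l') * (q k).eval (w l'))) / ∑ l', ν l' * ((q k).eval (w l')) ^ 2) ^ 2 * ∑ l', ν l' * ((q k).eval (w l')) ^ 2 +
        ∑ l, ν l * ((P - ∑ j ∈ Finset.range (n + 1), C ((∑ l', ν l' * (P.eval (w l') * (q j).eval (w l'))) / ∑ l', ν l' * ((q j).eval (w l')) ^ 2) * q j).eval (w l)) ^ 2 ∧
      ((∀ l, 0 ≤ ν l) → ∑ k ∈ Finset.range (n + 1), ((∑ l', ν l' * (P.eval (w l') * (q k).eval (w l'))) / ∑ l', ν l' * ((q k).eval (w l')) ^ 2) ^ 2 * ∑ l', ν l' * ((q k).eval (w l')) ^ 2 ≤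
        ∑ l, ν l * (P.eval (w l)) ^ 2) := by
  set S : ℝ[X] := ∑ j ∈ Finset.range (n + 1), C ((∑ l', ν l' * (P.eval (w l') * (q j).eval (w l'))) / ∑ l', ν l' * ((q j).eval (w l')) ^ 2) * q j with hS
  have hSd : S.natDegree ≤ n := natDegree_sum_le_of_forall_le _ _ fun j hj =>
    (natDegree_C_mul_le _ _).trans (by rw [hdeg j (Nat.lt_succ_iff.1 (Finset.mem_range.1 hj))]; exact Nat.lt_succ_iff.1 (Finset.mem_range.1 hj))
  have hcross := fourier_partialSum_orthogonal hmonic hdeg horth hh P hSd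
  have hpar := parseval_partialSum hdeg horth hh P
  have hid : ∑ l, ν l * (P.eval (w l)) ^ 2 = ∑ l, ν l * (S.eval (w l)) ^ 2 + ∑ l, ν l * ((P - S).eval (w l)) ^ 2 := by
    have hl : ∀ l, ν l * (P.eval (w l)) ^ 2 = ν l * (S.eval (w l)) ^ 2 + ν l * ((P - S).eval (w l)) ^ 2 + 2 * (ν l * ((P - S).eval (w l) * S.eval (w l))) := fun l => by
      rw [eval_sub]; ring
    rw [Finset.sum_congr rfl fun l _ => hl l, Finset.sum_add_distrib, Finset.sum_add_distrib, ← Finset.mul_sum, hcross, mul_zero, add_zero]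
  refine ⟨by rw [hid, hpar], fun hν => ?_⟩
  rw [hid, hpar]
  exact le_add_of_nonneg_right (Finset.sum_nonneg fun l _ => mul_nonneg (hν l) (sq_nonneg _))

/-- **THE KERNEL IS AN IDEMPOTENT: `Σ_l ν_l K_n(x, w_l) K_n(w_l, y) = K_n(x, y)`** (the reproducing property applied to `K_n(·, y)`). [Szegő (3.1.10); Aronszajn 1950 §2; this file, §1083] -/
theorem kernel_compose {N m : ℕ} {ν w : Fin N → ℝ} {q : ℕ → ℝ[X]} (hmonic : ∀ k, k ≤ m → (q k).Monic) (hdeg : ∀ k, k ≤ m → (q k).natDegree = k)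
    (horth : ∀ k, k ≤ m → ∀ G : ℝ[X], G.natDegree < k → ∑ l, ν l * (q k * G).eval (w l) = 0) (hh : ∀ k, k ≤ m → ∑ l, ν l * ((q k).eval (w l)) ^ 2 ≠ 0)
    {n : ℕ} (hn : n ≤ m) (x y : ℝ) :
    ∑ l, ν l * ((∑ k ∈ Finset.range (n + 1), C ((q k).eval x / ∑ l, ν l * ((q k).eval (w l)) ^ 2) * q k).eval (w l) *
      (∑ k ∈ Finset.range (n + 1), C ((q k).eval y / ∑ l, ν l * ((q k).eval (w l)) ^ 2) * q k).eval (w l)) =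
      (∑ k ∈ Finset.range (n + 1), C ((q k).eval y / ∑ l, ν l * ((q k).eval (w l)) ^ 2) * q k).eval x := by
  have h := kernel_reproducing hmonic hdeg horth hh hn (natDegree_reproducingKernel_le (ν := ν) (w := w) (n := n) (fun k hk => hdeg k (hk.trans hn)) y) x
  rw [← h]
  exact Finset.sum_congr rfl fun l _ => by rw [eval_mul]

/-- **`K_n(x, y)² ≤ K_n(x, x) K_n(y, y)`** for `ν ≥ 0` (Cauchy–Schwarz through N296 applied to `P = K_n(·, y)`, whose weighted square-sum is `K_n(y, y)`). [Szegő (3.1.11); Aronszajn 1950 §2; this file, §1083] -/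
theorem kernelPoly_sq_le_mul {N m : ℕ} {ν w : Fin N → ℝ} (hν : ∀ l, 0 ≤ ν l) {q : ℕ → ℝ[X]} (hmonic : ∀ k, k ≤ m → (q k).Monic) (hdeg : ∀ k, k ≤ m → (q k).natDegree = k)
    (horth : ∀ k, k ≤ m → ∀ G : ℝ[X], G.natDegree < k → ∑ l, ν l * (q k * G).eval (w l) = 0) (hh : ∀ k, k ≤ m → ∑ l, ν l * ((q k).eval (w l)) ^ 2 ≠ 0)
    {n : ℕ} (hn : n ≤ m) (x y : ℝ) :
    ((∑ k ∈ Finset.range (n + 1), C ((q k).eval y / ∑ l, ν l * ((q k).eval (w l)) ^ 2) * q k).eval x) ^ 2 ≤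
      (∑ k ∈ Finset.range (n + 1), C ((q k).eval x / ∑ l, ν l * ((q k).eval (w l)) ^ 2) * q k).eval x *
        (∑ k ∈ Finset.range (n + 1), C ((q k).eval y / ∑ l, ν l * ((q k).eval (w l)) ^ 2) * q k).eval y := by
  have hKd := natDegree_reproducingKernel_le (ν := ν) (w := w) (q := q) (n := n) (fun k hk => hdeg k (hk.trans hn)) y
  have h := eval_sq_le_kernel_mul_sum_sq hν hmonic hdeg horth hh hn hKd x
  rwa [sum_mul_eval_kernelPoly_sq hmonic hdeg horth hh hn y] at h

end Summit.Ventures.HSemireg.Wedge.HankelOuter
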